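import Summits.HodgeConjecture.HodgeConjecture.Theses.HeckePrymWeil
import Summits.HodgeConjecture.HodgeConjecture.Theses.AnchorTransport
import Summits.HodgeConjecture.HodgeConjecture.Theorems.HeckePrymWeilCmLadderAnchor
import Summits.HodgeConjecture.HodgeConjecture.Theorems.HeckePrymWeilHeckePrymAnchorsGlobalClassOfLeray
import Summits.HodgeConjecture.HodgeConjecture.Theorems.HeckePrymWeilHeckePrymAnchorsRationalAlongSection
import Summits.HodgeConjecture.HodgeConjecture.Theorems.HeckePrymWeilHeckePrymAnchorsUpgrade
import Literature.AlgebraicGeometry.HodgeTheory.InvariantClassesFromTotalSpaceHolds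
import Literature.AlgebraicGeometry.HodgeTheory.WeilFamilyReachSystem
import Literature.AlgebraicGeometry.HodgeTheory.WeilClassesDescendingHolds
import Literature.AlgebraicGeometry.HodgeTheory.WeilClassesDescendingTransfer
import Literature.AlgebraicGeometry.HodgeTheory.FermatHypersurfaceReduction
import HarnessLib

/-!
# Route `HeckePrymWeil`, CM-anchor ladder · EVERY RUNG from variational Hodge + Deligne's Weil family

The whole `ℚ(√-p)` Hodge–Weil sector of the route — the target `HodgeWeilLadder` (stmt-HodgeConjecture-1259)
and its rung cruxes `WeilSixfoldsSqrtMinus7` (1260), `WeilTwelvefoldsSqrtMinus7` (1261),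
`WeilTenfoldsSqrtMinus11` (1262), `HyperbolicEightfoldsSqrtMinus7` (14642) — is reduced here to the
route's transport crux `WeilVariationalHodge` (stmt-HodgeConjecture-14497: Grothendieck's variational
Hodge conjecture along `ℚ(√-p)`-Weil families) and ONE classical named fact, Deligne's polarized Weil
family over the hyperbolic component `weilFamily_hyperbolic_weilSystem_reach` (LNM 900, proof of
Thm. 4.8; van Geemen LNM 1594 §5; the tree has no universal abelian scheme).  The mechanism is the
CM-anchor ladder of crux 1261's line `isotypic-unimodular-saturation` (skeleton r2, lead seat c3), run in
EVERY dimension and for EVERY `d ≥ 1` in the tree's strong typing: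

* `weilClasses_algebraic_of_transport_of_reach` — for `n, d ≥ 1`: IF the generic transport holds along
  smooth projective families of `ℚ(√-d)`-Weil `2(n+1)`-folds (`WeilVariationalHodge`'s body at
  `M = n + 1`) and Deligne's family fact holds, THEN every rational `(n,n)` class of the Weil plane
  `weilClassesOf A φ n d` of every complex abelian `2n`-fold `(A, φ)`, `φ² = -d`, is ALGEBRAIC.
  Proof: partner CM square `B` with descent partner and aiming
  (`exists_weilTypeSurface_prod_isHyperbolicWeilType_all_holds`, Markman §11.5 Step 2) puts `A × B` on
  the hyperbolic component; the named fact gives the family through `A × B`, the flat Weil section of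
  any rational `(n+1,n+1)` Weil class `u` of `A × B` globalises by Deligne 1968
  (`stub_globalClassOfSection_of_leray` + `deligne1968_invariantClass_fromTotalSpace_holds`) to a class
  rational everywhere (`stub_rationalAlongSection`), `(n+1,n+1)` and fibrewise-Weil everywhere; the CM
  ANCHOR `B^n × B` (`exists_cmAnchor_hyperbolic`: hyperbolic, algebraic Weil plane) is reached up to a
  `K`-isogeny by a fibre, whose Weil plane is then algebraic
  (`weilClassesOf_le_algebraicClasses_of_isogenyPair`), so the global class is algebraic there;
  transport makes `u` algebraic; Schoen's descent `2n+2 → 2n`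
  (`Schoen1998_weilClasses_algebraic_of_prod_surface_all_holds`) returns to `A`.
* `hodgeWeil_of_weilVariationalHodge_of_reach` — the route's single-operator typing, every prime
  `p ≡ 3 (4)`, `p ≥ 7`, EVERY `n ≥ 1` (typing bridge `HeckePrymWeilLine.stub_upgrade`);
* `hodgeWeilLadder_of_weilVariationalHodge_of_reach : WeilVariationalHodge → (F3) → HodgeWeilLadder`
  and the rung cruxes `weilSixfoldsSqrtMinus7_…`, `weilTenfoldsSqrtMinus11_…`, `hyperbolicEightfoldsSqrtMinus7_…`
  from the same two hypotheses (the rung 1261 itself is `IsotypicUnimodularSaturation.weilTwelvefolds_of_weilVariationalHodge_of_reach`,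
  file `…IsotypicCmAnchor`, the `n = 6` case; it also follows from `hodgeWeil_of_weilVariationalHodge_of_reach` at `p = 7`, `n = 6`).

CONDITIONAL on exactly the two hypotheses spelled out (one open crux, one named fact); no `sorry`, no
new definition.  The Hecke–Prym anchors (`HeckePrymAnchors`, Schoen 1988, Patel–Zhang, the `F₂₁` data)
are not needed for this reduction: on the CM anchors every Weil class is algebraic by divisors.
-/

noncomputable section

-- every declaration of this problem lives in Summit.HodgeConjecture.HodgeConjecture.… (summit = sub-problem)
set_option linter.dupNamespace false

open CategoryTheory
open Literature.AlgebraicGeometry Literature.AlgebraicGeometry.Motives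
  Literature.AlgebraicGeometry.HodgeTheory Literature.AlgebraicTopology.SingularHomology

namespace Summit.HodgeConjecture.HodgeConjecture.Theorems.HeckePrymWeilLine

/-! ### The strong-typing theorem, every `d ≥ 1`, every `n ≥ 1` -/

/-- **Hodge–Weil classes are algebraic in dimension `2n`, GIVEN the generic transport in relative
dimension `2(n+1)` and Deligne's hyperbolic Weil family** (every `d ≥ 1`, every `n ≥ 1`; strong
typing `weilClassesOf`).  See the module docstring for the proof: partner CM square + aiming, the
family through `A × B`, globalisation of flat Weil sections (Deligne 1968), the CM anchor `B^n × B`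
reached up to `K`-isogeny (algebraic Weil plane), transport, Schoen's descent.
[cite: Deligne1982HodgeCycles, proof of Thm. 4.8 (pp. 47–52) with Prop. 4.4]
[cite: Schoen1998HodgeWeilAddendum, §10 (Proposition and proof)] [cite: Markman2025SurveySecant, §11.5 Step 1–2]
[cite: vanGeemen1994HodgeAV, §5 and proof of Thm. 6.12] [cite: Grothendieck1966, footnote 13] -/
theorem weilClasses_algebraic_of_transport_of_reach {n d : ℕ} (hn : 0 < n) (hd : 0 < d)
    (hT : ∀ ⦃𝒳 S : SchemeOver ℂ⦄ (f : 𝒳 ⟶ S), IsSmoothProjectiveFamily f (2 * (n + 1)) →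
      IrreducibleSpace S.left → AlgebraicGeometry.Smooth S.hom →
      ∀ (W : complexBetti 𝒳 (2 * (n + 1))),
        (∀ s : ComplexPoints S, IsRationalClass (complexBetti.map (fiberι f s) (2 * (n + 1)) W) ∧
          IsOfHodgeType (2 * (n + 1)) (fiberOver f s) (2 * (n + 1)) (n + 1) (n + 1)
            (complexBetti.map (fiberι f s) (2 * (n + 1)) W)) →
        (∀ s : ComplexPoints S, ∃ (A' : AbelianVariety ℂ) (φ' : A' ⟶ A'),
          A'.dim = 2 * (n + 1) ∧ φ' ≫ φ' = -((d : ℤ) • 𝟙 A') ∧ Nonempty (A'.X ≅ fiberOver f s)) →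
        (∃ s₀ : ComplexPoints S, complexBetti.map (fiberι f s₀) (2 * (n + 1)) W ∈
          algebraicClasses (fiberOver f s₀) (n + 1)) →
        ∀ s : ComplexPoints S, complexBetti.map (fiberι f s) (2 * (n + 1)) W ∈
          algebraicClasses (fiberOver f s) (n + 1))
    (hR : weilFamily_hyperbolic_weilSystem_reach) :
    ∀ (A : AbelianVariety ℂ) (φ : A ⟶ A), A.dim = 2 * n → φ ≫ φ = -(d • 𝟙 A) →
      ∀ c : complexBetti A.X (2 * n), IsRationalClass c → IsOfHodgeType (2 * n) A.X (2 * n) n n c →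
        c ∈ weilClassesOf A φ n d → c ∈ algebraicClasses A.X n := by
  intro A φ hA hφ c hrat hH hcW
  by_cases hc : c = 0
  · rw [hc]
    exact Submodule.zero_mem _
  have hAsp : IsSmoothProjective (2 * n) A.X := sps_isSmoothProjective_of_dim_eq A hA
  -- partner CM square with descent partner, and aiming of `A × B` onto the hyperbolic component
  obtain ⟨B, φB, hB, hBsp, hφB, ⟨up, um, hup, hum, hrat₂, hH₂, hup0, hum0, t, ht, hupt, humt⟩, e, a, ha,
    ha0, hhyp⟩ :=
    exists_weilTypeSurface_prod_isHyperbolicWeilType_all_holds n hn d hd A φ hA hAsp hφ ⟨c, hrat, hH, hcW, hc⟩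
  -- Schoen's descent `2n + 2 → 2n` for this partner
  refine Schoen1998_weilClasses_algebraic_of_prod_surface_all_holds n hn d hd A φ B φB hA hAsp hφ hB hBsp
    hφB ⟨up, um, hup, hum, hrat₂, hH₂, hup0, hum0, t, ht, hupt, humt⟩ ?_ c hrat hH hcW
  -- every rational `(n+1,n+1)` Weil class `u` of `A × B` is algebraic
  intro u hur huH huW
  set Φ := AbelianVariety.prodLift (AbelianVariety.fst A B ≫ φ) (AbelianVariety.snd A B ≫ φB) with hΦdef
  have hX : (A.prod B).dim = 2 * (n + 1) := by rw [AbelianVariety.dim_prod, hA, hB]; ring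
  have hΦn : Φ ≫ Φ = -(d • 𝟙 (A.prod B)) := prodLift_comp_self_eq_neg_nsmul hφ hφB
  have hΦ : Φ ≫ Φ = -((d : ℤ) • 𝟙 (A.prod B)) := by rw [natCast_zsmul]; exact hΦn
  -- the hyperbolic Weil family through `A × B` (the named fact)
  obtain ⟨𝒳, S, f, s₁, e₁, Y, Ψ, ε, hfam, hemb, hirr, hsm, hqp, hYs, hsec, hreach⟩ :=
    hR (n + 1) d (by omega) hd (A.prod B) Φ e a hX hΦ ha ha0 hhyp
  -- the flat Weil section of `u`, and the global class of the section (Deligne 1968)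
  obtain ⟨σ, hσc, hσ₁, hσ⟩ := hsec u huW
  have hpt : ∀ s, (σ s).pt = s := fun s => by
    obtain ⟨x, hx, -⟩ := hσ s
    rw [hx]
  obtain ⟨𝒰, h𝒰⟩ :=
    stub_globalClassOfSection_of_leray deligne1968_invariantClass_fromTotalSpace_holds f (2 * (n + 1))
      (2 * (n + 1)) hfam hemb hsm hqp hirr σ hσc hpt
  have hcls : ∀ (s : ComplexPoints S) (x : complexBetti (fiberOver f s) (2 * (n + 1))),
      σ s = ⟨s, x⟩ → complexBetti.map (fiberι f s) (2 * (n + 1)) 𝒰 = x := by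
    intro s x hx
    have h := (h𝒰 s).symm.trans hx
    simp only [globalSection, FiberClass.mk.injEq, heq_eq_eq, true_and] at h
    exact h
  -- rationality along the section
  have hrat₁ : IsRationalClass (σ s₁).cls := by
    rw [hσ₁]
    exact hur.map _
  have hratσ : ∀ s, IsRationalClass (σ s).cls :=
    stub_rationalAlongSection f (2 * (n + 1)) (2 * (n + 1)) hfam hsm hqp hirr σ hσc hpt s₁ hrat₁
  -- `𝒰` is rational `(n+1,n+1)` on every fibre …
  have hall : ∀ s : ComplexPoints S, IsRationalClass (complexBetti.map (fiberι f s) (2 * (n + 1)) 𝒰) ∧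
      IsOfHodgeType (2 * (n + 1)) (fiberOver f s) (2 * (n + 1)) (n + 1) (n + 1)
        (complexBetti.map (fiberι f s) (2 * (n + 1)) 𝒰) := by
    intro s
    obtain ⟨x, hx, hxH, -⟩ := hσ s
    have h₁ := hratσ s
    rw [hx] at h₁
    rw [hcls s x hx]
    exact ⟨h₁, hxH⟩
  -- … every fibre is a `ℚ(√-d)`-Weil abelian `2(n+1)`-fold …
  have hfib : ∀ s : ComplexPoints S, ∃ (A' : AbelianVariety ℂ) (φ' : A' ⟶ A'),
      A'.dim = 2 * (n + 1) ∧ φ' ≫ φ' = -((d : ℤ) • 𝟙 A') ∧ Nonempty (A'.X ≅ fiberOver f s) := by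
    intro s
    obtain ⟨hYdim, hΨ⟩ := hYs s
    exact ⟨Y s, Ψ s, hYdim, hΨ, ⟨ε s⟩⟩
  -- … and `𝒰` is ALGEBRAIC on the fibre reaching the CM anchor `B^n × B`
  have hanchor : ∃ s₀ : ComplexPoints S, complexBetti.map (fiberι f s₀) (2 * (n + 1)) 𝒰 ∈
      algebraicClasses (fiberOver f s₀) (n + 1) := by
    obtain ⟨X, ΦX, e', a', hXdim, hΦX, ha', ha0', hhypX, hXalg⟩ := exists_cmAnchor_hyperbolic hd hn
    have hΦX' : ΦX ≫ ΦX = -((d : ℤ) • 𝟙 X) := by rw [natCast_zsmul]; exact hΦX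
    obtain ⟨s₀, fY, gY, m, hflat, hm, hfg, hgψ⟩ := hreach X ΦX e' a' hXdim hΦX' ha' ha0' hhypX
    -- the Weil plane of the fibre `(Y_{s₀}, Ψ_{s₀})` is algebraic
    have hYalg : weilClassesOf (Y s₀) (Ψ s₀) (n + 1) d ≤ algebraicClasses (Y s₀).X (n + 1) :=
      weilClassesOf_le_algebraicClasses_of_isogenyPair hXalg fY gY m hflat hm hfg hgψ
    obtain ⟨x₀, hx₀, -, hx₀W⟩ := hσ s₀
    have hxY : complexBetti.map (ε s₀).hom (2 * (n + 1)) x₀ ∈ algebraicClasses (Y s₀).X (n + 1) :=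
      hYalg hx₀W
    refine ⟨s₀, ?_⟩
    have key := mem_algebraicClasses_map_of_iso (p := n + 1)
      (AbelianVariety.isSmoothProjective_holds (A := Y s₀)) (hfam.isSmoothProjective s₀) (ε s₀).symm hxY
    have hid : complexBetti.map (ε s₀).symm.hom (2 * (n + 1))
        (complexBetti.map (ε s₀).hom (2 * (n + 1)) x₀) = x₀ := by
      rw [← CategoryTheory.comp_apply, ← complexBetti.map_comp, Iso.symm_hom, Iso.inv_hom_id,
        complexBetti.map_id]
      rfl
    rw [hid] at key
    rw [hcls s₀ x₀ hx₀]
    exact key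
  -- transport to the fibre over `s₁`, and back along `e₁ : A × B ≅ 𝒳_{s₁}`
  have h𝒰 := hT f hfam hirr hsm 𝒰 hall hfib hanchor s₁
  have key := mem_algebraicClasses_map_of_iso (p := n + 1) (hfam.isSmoothProjective s₁)
    (AbelianVariety.isSmoothProjective_holds (A := A.prod B)) e₁ h𝒰
  have hu : complexBetti.map e₁.hom (2 * (n + 1)) (complexBetti.map (fiberι f s₁) (2 * (n + 1)) 𝒰) = u := by
    rw [hcls s₁ _ hσ₁, ← CategoryTheory.comp_apply, ← complexBetti.map_comp, Iso.hom_inv_id,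
      complexBetti.map_id]
    rfl
  rw [hu] at key
  exact key

/-! ### The route's typing: every prime `p ≡ 3 (4)`, `p ≥ 7`, every `n ≥ 1` -/

/-- **Every rung of the `ℚ(√-p)` Hodge–Weil ladder from `WeilVariationalHodge` and Deligne's Weil
family** (route typing: the typed Weil plane `Eig((𝟙+φ)^*, (1+i√p)^{2n}) ⊔ Eig((𝟙+φ)^*, (1-i√p)^{2n})`,
`p ≡ 3 (4)` prime, `p ≥ 7`, EVERY `n ≥ 1`): typing bridge `stub_upgrade` (typed ⊆ strong) and
`weilClasses_algebraic_of_transport_of_reach` with the transport supplied by `WeilVariationalHodge` at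
`M = n + 1`. [cite: Grothendieck1966, footnote 13] [cite: Deligne1982HodgeCycles, proof of Thm. 4.8]
[cite: Schoen1998HodgeWeilAddendum, §10] [cite: vanGeemen1994HodgeAV, §5 and proof of Thm. 6.12] -/
theorem hodgeWeil_of_weilVariationalHodge_of_reach
    (hW : Summit.HodgeConjecture.HodgeConjecture.Theses.HeckePrymWeil.WeilVariationalHodge)
    (hR : weilFamily_hyperbolic_weilSystem_reach) :
    ∀ p : ℕ, p.Prime → p % 4 = 3 → 7 ≤ p → ∀ n : ℕ, 1 ≤ n →
      ∀ (A : AbelianVariety ℂ) (φ : A ⟶ A), A.dim = 2 * n → φ ≫ φ = -((p : ℤ) • 𝟙 A) →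
      ∀ c : complexBetti A.X (2 * n), IsRationalClass c → IsOfHodgeType (2 * n) A.X (2 * n) n n c →
        c ∈ Module.End.eigenspace (complexBetti.map (𝟙 A + φ).hom.hom.hom (2 * n)).hom
              ((1 + Complex.I * (Real.sqrt (p : ℝ) : ℂ)) ^ (2 * n)) ⊔
            Module.End.eigenspace (complexBetti.map (𝟙 A + φ).hom.hom.hom (2 * n)).hom
              ((1 - Complex.I * (Real.sqrt (p : ℝ) : ℂ)) ^ (2 * n)) →
        c ∈ algebraicClasses A.X n := by
  intro p hp hp3 hp7 n hn A φ hA hφ c hrat hH hcE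
  have hcW : c ∈ weilClassesOf A φ n p := stub_upgrade p hp hp3 hp7 n A φ hA hφ hcE
  have hφn : φ ≫ φ = -(p • 𝟙 A) := by rw [← natCast_zsmul]; exact hφ
  refine weilClasses_algebraic_of_transport_of_reach (n := n) (d := p) (by omega) hp.pos ?_ hR A φ hA hφn
    c hrat hH hcW
  intro 𝒳 S f hf hirr hsm W hall hfib hanchor s
  exact hW p hp hp3 hp7 (n + 1) (by omega) f hf hirr hsm W hall hfib hanchor s

/-! ### The route target and the rung cruxes -/

/-- **The route target `HodgeWeilLadder` (stmt-HodgeConjecture-1259) from `WeilVariationalHodge`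
(stmt-14497) and Deligne's Weil family** — every rung `(p, g')` is the case `n = (p-1)/2·(g'-1) ≥ 3`
of `hodgeWeil_of_weilVariationalHodge_of_reach`. [cite: Grothendieck1966, footnote 13]
[cite: Deligne1982HodgeCycles, proof of Thm. 4.8] [cite: Schoen1998HodgeWeilAddendum, §10] -/
theorem hodgeWeilLadder_of_weilVariationalHodge_of_reach
    (hW : Summit.HodgeConjecture.HodgeConjecture.Theses.HeckePrymWeil.WeilVariationalHodge)
    (hR : weilFamily_hyperbolic_weilSystem_reach) :
    Summit.HodgeConjecture.HodgeConjecture.Theses.HeckePrymWeil.HodgeWeilLadder := by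
  intro p hp hp3 hp7 g hg n hn' A φ hA hφ c hrat hH hcE
  have hn : 1 ≤ n := by
    rw [hn']
    have h1 : 3 ≤ (p - 1) / 2 := by omega
    have h2 : 1 ≤ g - 1 := by omega
    calc 1 ≤ 3 * 1 := by norm_num
      _ ≤ (p - 1) / 2 * (g - 1) := Nat.mul_le_mul h1 h2
  exact hodgeWeil_of_weilVariationalHodge_of_reach hW hR p hp hp3 hp7 n hn A φ hA hφ c hrat hH hcE

/-- **Crux `WeilSixfoldsSqrtMinus7` (stmt-HodgeConjecture-1260) from `WeilVariationalHodge` and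
Deligne's Weil family** (`p = 7`, `n = 3`; every discriminant).
[cite: Grothendieck1966, footnote 13] [cite: Deligne1982HodgeCycles, proof of Thm. 4.8] -/
theorem weilSixfoldsSqrtMinus7_of_weilVariationalHodge_of_reach
    (hW : Summit.HodgeConjecture.HodgeConjecture.Theses.HeckePrymWeil.WeilVariationalHodge)
    (hR : weilFamily_hyperbolic_weilSystem_reach) :
    Summit.HodgeConjecture.HodgeConjecture.Theses.HeckePrymWeil.WeilSixfoldsSqrtMinus7 := by
  intro A φ hA hφ c hrat hH hcE
  exact hodgeWeil_of_weilVariationalHodge_of_reach hW hR 7 (by norm_num) (by norm_num) le_rfl 3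
    (by norm_num) A φ hA (by exact_mod_cast hφ) c hrat hH (by exact_mod_cast hcE)

/-- **Crux `WeilTenfoldsSqrtMinus11` (stmt-HodgeConjecture-1262) from `WeilVariationalHodge` and
Deligne's Weil family** (`p = 11`, `n = 5`: the second field, same mechanism).
[cite: Grothendieck1966, footnote 13] [cite: Deligne1982HodgeCycles, proof of Thm. 4.8] -/
theorem weilTenfoldsSqrtMinus11_of_weilVariationalHodge_of_reach
    (hW : Summit.HodgeConjecture.HodgeConjecture.Theses.HeckePrymWeil.WeilVariationalHodge)
    (hR : weilFamily_hyperbolic_weilSystem_reach) :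
    Summit.HodgeConjecture.HodgeConjecture.Theses.HeckePrymWeil.WeilTenfoldsSqrtMinus11 := by
  intro A φ hA hφ c hrat hH hcE
  exact hodgeWeil_of_weilVariationalHodge_of_reach hW hR 11 (by norm_num) (by norm_num) (by norm_num) 5
    (by norm_num) A φ hA (by exact_mod_cast hφ) c hrat hH (by exact_mod_cast hcE)

/-- **Crux `HyperbolicEightfoldsSqrtMinus7` (stmt-HodgeConjecture-14642) from `WeilVariationalHodge`
and Deligne's Weil family** (`p = 7`, `n = 4`; the hyperbolicity hypothesis is not even used: ALL
`ℚ(√-7)`-Weil eightfolds are covered). [cite: Grothendieck1966, footnote 13]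
[cite: Deligne1982HodgeCycles, proof of Thm. 4.8] -/
theorem hyperbolicEightfoldsSqrtMinus7_of_weilVariationalHodge_of_reach
    (hW : Summit.HodgeConjecture.HodgeConjecture.Theses.HeckePrymWeil.WeilVariationalHodge)
    (hR : weilFamily_hyperbolic_weilSystem_reach) :
    Summit.HodgeConjecture.HodgeConjecture.Theses.HeckePrymWeil.HyperbolicEightfoldsSqrtMinus7 := by
  intro A φ hA hφ _ _ _ _ _ c hrat hH hcE
  exact hodgeWeil_of_weilVariationalHodge_of_reach hW hR 7 (by norm_num) (by norm_num) le_rfl 4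
    (by norm_num) A φ hA (by exact_mod_cast hφ) c hrat hH (by exact_mod_cast hcE)

end Summit.HodgeConjecture.HodgeConjecture.Theorems.HeckePrymWeilLine

end
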